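import Summits.QuantumFields.YangMills.Theorems.BalabanUVNodesSpineReadingOfRecord13CoPH

/-!
# THE SPINE READING OF RECORD WITH THE PHYSICAL VOLUME LETTER — `YMDAG.UVSplit.crOfRecord₁₃V` (edition `V` of `crOfRecord₁₃`, `Thm/BalabanUVNodesSpineReadingOfRecord13CoPH`):
# the SAME runs, keys, class set, class weights, bad class, shell split letter and canonical weights ∕ rate, with `vol := F.side ^ 4` (the top lattice's site count
# `(2·L^m)⁴` as a real, K-independent) in place of the v1.0 normalisation `vol := 1`

Cell `pub-ymgap`, YM-PLAN Track A (HUMAN RULING D-0062; work-bound push D-0149); seat `pub-ymgap-dag-n20-d` (R134 (a) N20 NE7b s3 = the U5d lineage; plan g78 WORD-CR13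
pen) gen 28.  WHY A SIBLING AND NOT A v1.1: dag-n19-d DESIGN-POINT-VOL (pub-ymgap INBOX l.25098; confirmed by ref-K READ-197 and ref-I READ-351): N19's link reading
(`hlink`, `Thm/…N19…` F p583345, v9) READS `S.vol` as the PHYSICAL volume in five places — e.g. (ii-m) `(Fintype.card (Site (Pf K) (Pf K).K) : ℝ) = S.vol` — so a reading with
`vol := 1` makes that clause force a one-site lattice, i.e. UNINHABITABLE by the family's own lattices (an A6-type vacuity built into the reading), whereas with
`vol := F.side ^ 4` the clause is n19-w3's `card_site_top_family_real` (p586569 §7) literally.  The gate's append-only rule (`theorems.append-only`: «deprecate, don't mutate»)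
forbids re-pinning `vol` inside the landed `crOfRecord₁₃At` (p587226), hence this edition under a new name; the v1.0 objects `runA₁₃ ∕ runB₁₃ ∕ histA₁₃ ∕ histB₁₃ ∕ keyA₁₃ ∕
keyB₁₃ ∕ classSet₁₃ ∕ weightA₁₃ ∕ weightB₁₃ ∕ badClass₁₃ ∕ ShellSplit₁₃CoPH` and the E1 ∕ E2 theorems `schemeZ_(succ_)eq_sum_classSet_weight{A,B}` are REUSED BY NAME, nothing
re-declared.  For `NE7.Core` the volume letter is a normalisation the rate absorbs; for the reading OF RECORD it is the top lattice's site count — THIS edition is the one the K3⁷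
skeleton's live-line pin `PinnedAtLive` should name (plan g79, v2 145a664ea9c38a7b registered at `crOfRecord₁₃` eight minutes before the point was read; a v3 re-point is one token).

CONTENTS ([bookkeeping]; filed `--kind definition --supports stmt-QuantumFields-20544 --as helper`; COUNT-NEUTRAL): §1 `crOfRecord₁₃VAt K₀ jcut sh` ∕ `crOfRecord₁₃V := …VAt 0`;
§2 dictionary (`rfl`): `_ι ∕ _l₀ ∕ _vol (= F.side ^ 4) ∕ _K₀ ∕ _T ∕ _A ∕ _B ∕ _Bad ∕ _shA ∕ _shB ∕ _W ∕ _Wsh ∕ _δ`, `crOfRecord₁₃V_eq`; §3 ★★ `keyedExtraction_crOfRecord₁₃VAt`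
(E1 ∕ E2 + `0 < l₀`, `0 < vol` at the reading under the live-selector pin and B‴ §2's three laws, `ForSmallCouplings.of_forall`); §4 transfers ★ `relWeightBound_crOfRecord₁₃VAt` ·
★ `shellWeightBound_crOfRecord₁₃VAt` · ★ `core_crOfRecord₁₃VAt` · `lt_one_crOfRecord₁₃VAt` (any witness with any weights ∕ rate at the reading's carriers ⇒ the face AT the
reading, whose `W ∕ Wsh ∕ δ` are canonical).  The v1.0 header's reading notes (R1–R5, the two displayed letters `jcut` ∕ `sh`, the (ρ2) pin constraint on `θ.ppSel` of
dag-n20-w3's RESOLVED l.24400) apply VERBATIM.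

HONEST FRAMING.  A reading DEFINITION + dictionary + transfer bookkeeping; NO estimate; nothing of Bałaban's asserted; NE7 ∕ NE7b ∕ NE7c NOT PRINTED for d = 4 ∕ NOT proved;
the shell split is NOT inhabited (NODE O); no `Provisos₁₃CoPH` inhabitant claimed (K0⁷ OPEN); N19 ∕ N20 ∕ N21 ∕ N27 NOT discharged; K3⁷ NOT claimed; counts UNMOVED (typed
28∕28 · discharged 5∕27); one finite four-torus programme at fixed `ε` — NOT ℝ⁴, NOT OS, NOT a mass gap, NOT the Clay problem.  No decl below carries a cite tag.
-/

noncomputable section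

open scoped BigOperators
open Finset

namespace YMDAG.UVSplit

open Literature.MathematicalPhysics.QuantumFieldTheory.Balaban1983to89
open Literature.MathematicalPhysics.QuantumFieldTheory.Balaban1983to89.T4Continuum
open Literature.MathematicalPhysics.QuantumFieldTheory.Balaban1983to89.Node00
open T4WeightBudget (RelWeightBound)
open T4IndicatorShell (ShellWeightBound)
open T4ContinuumYM4Torus (ForSmallCouplings)
open Summit.QuantumFields.BalabanUV.T4Continuum.Spine
open Summit.QuantumFields.YangMills.BalabanUVNodes.SpineCanonicalWeights

variable {F : T4Family} {N : ℕ} [NeZero N]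

/-! ## §1 The reading with the physical volume letter -/

/-- **THE SPINE READING OF RECORD AT OFFSET `K₀`, PHYSICAL VOLUME LETTER**: `crOfRecord₁₃At` with `vol := F.side ^ 4` (and the canonical rate taken at that volume);
every other field is v1.0's. [bookkeeping] -/
def crOfRecord₁₃VAt (K₀ : ℕ) (jcut : ℕ → ℕ) (sh : ShellSplit₁₃CoPH N K₀) : SpineReading₁₃CoPH N := fun F θ hP g₀ os =>
  { ι := Σ K, SiteSeqKey F (K₀ + K)
    dec := Classical.decEq _
    l₀ := 1
    vol := F.side ^ 4
    K₀ := K₀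
    T := classSet₁₃ θ K₀ g₀
    A := weightA₁₃ θ hP K₀ g₀ os
    B := weightB₁₃ θ hP K₀ g₀ os
    shA := (sh F θ hP g₀ os).1
    shB := (sh F θ hP g₀ os).2
    Bad := badClass₁₃ θ K₀ g₀ jcut
    W := wInf 1 (classSet₁₃ θ K₀ g₀) (weightA₁₃ θ hP K₀ g₀ os) (weightB₁₃ θ hP K₀ g₀ os) (badClass₁₃ θ K₀ g₀ jcut)
    Wsh := wshInf 1 (classSet₁₃ θ K₀ g₀) (weightA₁₃ θ hP K₀ g₀ os) (weightB₁₃ θ hP K₀ g₀ os) (sh F θ hP g₀ os).1 (sh F θ hP g₀ os).2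
    δ := letI : DecidableEq (Σ K, SiteSeqKey F (K₀ + K)) := Classical.decEq _
      deltaCan 1 (F.side ^ 4) (classSet₁₃ θ K₀ g₀) (badClass₁₃ θ K₀ g₀ jcut)
        (fun K t x => weightA₁₃ θ hP K₀ g₀ os K t x - (sh F θ hP g₀ os).1 K t x) (fun K t x => weightB₁₃ θ hP K₀ g₀ os K t x - (sh F θ hP g₀ os).2 K t x) }

/-- ★★ **THE SPINE READING OF RECORD, PHYSICAL VOLUME LETTER**: `crOfRecord₁₃V := crOfRecord₁₃VAt 0`. [bookkeeping] -/
def crOfRecord₁₃V (jcut : ℕ → ℕ) (sh : ShellSplit₁₃CoPH N 0) : SpineReading₁₃CoPH N :=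
  crOfRecord₁₃VAt 0 jcut sh

/-! ## §2 The dictionary (all `rfl`) -/

section Dictionary

variable (K₀ : ℕ) (jcut : ℕ → ℕ) (sh : ShellSplit₁₃CoPH N K₀) (θ : Stage13HParams F N) (hP : θ.Provisos₁₃CoPH F N) (g₀ : ℕ → ℝ) (os : List (ULoop F))

/-- `ι`. [bookkeeping] -/
theorem crOfRecord₁₃VAt_ι : (crOfRecord₁₃VAt K₀ jcut sh F θ hP g₀ os).ι = (Σ K, SiteSeqKey F (K₀ + K)) := rfl
/-- `l₀ = 1`. [bookkeeping] -/
@[simp] theorem crOfRecord₁₃VAt_l₀ : (crOfRecord₁₃VAt K₀ jcut sh F θ hP g₀ os).l₀ = 1 := rfl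
/-- **`vol = F.side ^ 4`** — the top lattice's site count as a real (n19-w3's `card_site_top_family_real`). [bookkeeping] -/
theorem crOfRecord₁₃VAt_vol : (crOfRecord₁₃VAt K₀ jcut sh F θ hP g₀ os).vol = F.side ^ 4 := rfl
/-- `K₀`. [bookkeeping] -/
@[simp] theorem crOfRecord₁₃VAt_K₀ : (crOfRecord₁₃VAt K₀ jcut sh F θ hP g₀ os).K₀ = K₀ := rfl
/-- `T` = the keyed class set. [bookkeeping] -/
theorem crOfRecord₁₃VAt_T : (crOfRecord₁₃VAt K₀ jcut sh F θ hP g₀ os).T = classSet₁₃ θ K₀ g₀ := rfl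
/-- `A` = run A's fibre sums. [bookkeeping] -/
theorem crOfRecord₁₃VAt_A : (crOfRecord₁₃VAt K₀ jcut sh F θ hP g₀ os).A = weightA₁₃ θ hP K₀ g₀ os := rfl
/-- `B` = run B's fibre sums. [bookkeeping] -/
theorem crOfRecord₁₃VAt_B : (crOfRecord₁₃VAt K₀ jcut sh F θ hP g₀ os).B = weightB₁₃ θ hP K₀ g₀ os := rfl
/-- `Bad` = the persistence class. [bookkeeping] -/
theorem crOfRecord₁₃VAt_Bad : (crOfRecord₁₃VAt K₀ jcut sh F θ hP g₀ os).Bad = badClass₁₃ θ K₀ g₀ jcut := rfl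
/-- `shA`. [bookkeeping] -/
theorem crOfRecord₁₃VAt_shA : (crOfRecord₁₃VAt K₀ jcut sh F θ hP g₀ os).shA = (sh F θ hP g₀ os).1 := rfl
/-- `shB`. [bookkeeping] -/
theorem crOfRecord₁₃VAt_shB : (crOfRecord₁₃VAt K₀ jcut sh F θ hP g₀ os).shB = (sh F θ hP g₀ os).2 := rfl
/-- `W` = the canonical least relative weight of the bad class. [bookkeeping] -/
theorem crOfRecord₁₃VAt_W : (crOfRecord₁₃VAt K₀ jcut sh F θ hP g₀ os).W =
    wInf 1 (classSet₁₃ θ K₀ g₀) (weightA₁₃ θ hP K₀ g₀ os) (weightB₁₃ θ hP K₀ g₀ os) (badClass₁₃ θ K₀ g₀ jcut) := rfl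
/-- `Wsh` = the canonical relative shell weight. [bookkeeping] -/
theorem crOfRecord₁₃VAt_Wsh : (crOfRecord₁₃VAt K₀ jcut sh F θ hP g₀ os).Wsh =
    wshInf 1 (classSet₁₃ θ K₀ g₀) (weightA₁₃ θ hP K₀ g₀ os) (weightB₁₃ θ hP K₀ g₀ os) (sh F θ hP g₀ os).1 (sh F θ hP g₀ os).2 := rfl
/-- `δ` = the canonical rate at the physical volume. [bookkeeping] -/
theorem crOfRecord₁₃VAt_δ : (crOfRecord₁₃VAt K₀ jcut sh F θ hP g₀ os).δ =
    (letI : DecidableEq (Σ K, SiteSeqKey F (K₀ + K)) := Classical.decEq _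
     deltaCan 1 (F.side ^ 4) (classSet₁₃ θ K₀ g₀) (badClass₁₃ θ K₀ g₀ jcut)
      (fun K t x => weightA₁₃ θ hP K₀ g₀ os K t x - (sh F θ hP g₀ os).1 K t x) (fun K t x => weightB₁₃ θ hP K₀ g₀ os K t x - (sh F θ hP g₀ os).2 K t x)) := rfl
/-- The two editions share every carrier: `T ∕ A ∕ B ∕ Bad ∕ shA ∕ shB ∕ W ∕ Wsh ∕ l₀ ∕ K₀` of `crOfRecord₁₃VAt` ARE `crOfRecord₁₃At`'s (`rfl`). [bookkeeping] -/
theorem crOfRecord₁₃VAt_T_eq : (crOfRecord₁₃VAt K₀ jcut sh F θ hP g₀ os).T = (crOfRecord₁₃At K₀ jcut sh F θ hP g₀ os).T := rfl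
/-- The record object reads the offset-`0` form (`rfl`). [bookkeeping] -/
theorem crOfRecord₁₃V_eq (jcut : ℕ → ℕ) (sh : ShellSplit₁₃CoPH N 0) : crOfRecord₁₃V jcut sh = crOfRecord₁₃VAt 0 jcut sh := rfl

end Dictionary

/-! ## §3 The extraction face as a THEOREM -/

section Extraction

variable (K₀ : ℕ) (jcut : ℕ → ℕ) (sh : ShellSplit₁₃CoPH N K₀) (θ : Stage13HParams F N) (hP : θ.Provisos₁₃CoPH F N) (E : B12.RunParams → ℝ)

/-- ★★ **THE EXTRACTION FACE OF K3⁷ AT THE READING (PHYSICAL VOLUME) IS A THEOREM** under the live-selector pin and B‴ §2's three laws: `0 < l₀`, `0 < vol = (2L^m)⁴`, E1 ∕ E2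
for EVERY `g₀`. [bookkeeping] -/
theorem keyedExtraction_crOfRecord₁₃VAt (hsel : θ.ppSel = ppSelLiveOfRecord F N θ.ν θ.τ9 E (wOfRecord₉ F N θ.toStage9Params))
    (hU : LocalBgMeasurable F N θ.ν) (hζm : ZetaMeasurable F N θ.ζ) (hζ0 : ∀ p g k s Pl Ql RS U V', 0 ≤ θ.ζ p g k s Pl Ql RS U V') :
    ForSmallCouplings (datumOfRecord₁₃CoPH F N θ hP) fun g₀ => ∀ os : List (ULoop F),
      0 < (crOfRecord₁₃VAt K₀ jcut sh F θ hP g₀ os).l₀ ∧ 0 < (crOfRecord₁₃VAt K₀ jcut sh F θ hP g₀ os).vol ∧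
      (∀ (K : ℕ) (t : ℝ), |t| ≤ (crOfRecord₁₃VAt K₀ jcut sh F θ hP g₀ os).l₀ →
        T4GenFunBounds.schemeZ ((datumOfRecord₁₃CoPH F N θ hP).scheme g₀) os ((crOfRecord₁₃VAt K₀ jcut sh F θ hP g₀ os).K₀ + K) t =
          ∑ τ ∈ (crOfRecord₁₃VAt K₀ jcut sh F θ hP g₀ os).T K, (crOfRecord₁₃VAt K₀ jcut sh F θ hP g₀ os).A K t τ) ∧
      (∀ (K : ℕ) (t : ℝ), |t| ≤ (crOfRecord₁₃VAt K₀ jcut sh F θ hP g₀ os).l₀ →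
        T4GenFunBounds.schemeZ ((datumOfRecord₁₃CoPH F N θ hP).scheme g₀) os ((crOfRecord₁₃VAt K₀ jcut sh F θ hP g₀ os).K₀ + K + 1) t =
          ∑ τ ∈ (crOfRecord₁₃VAt K₀ jcut sh F θ hP g₀ os).T K, (crOfRecord₁₃VAt K₀ jcut sh F θ hP g₀ os).B K t τ) :=
  ForSmallCouplings.of_forall fun g₀ os =>
    ⟨one_pos, pow_pos F.side_pos 4, fun K t _ => schemeZ_eq_sum_classSet_weightA K₀ θ hP E hsel hU hζm hζ0 g₀ os K t,
      fun K t _ => schemeZ_succ_eq_sum_classSet_weightB K₀ θ hP E hsel hU hζm hζ0 g₀ os K t⟩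

end Extraction

/-! ## §4 Face transfers at the physical-volume reading -/

section Transfer

variable (K₀ : ℕ) (jcut : ℕ → ℕ) (sh : ShellSplit₁₃CoPH N K₀) (θ : Stage13HParams F N) (hP : θ.Provisos₁₃CoPH F N) (g₀ : ℕ → ℝ) (os : List (ULoop F))

/-- ★ **N20 AT THE READING FROM ANY WITNESS**. [bookkeeping] -/
theorem relWeightBound_crOfRecord₁₃VAt {W : ℕ → ℝ}
    (h : RelWeightBound 1 (classSet₁₃ θ K₀ g₀) (weightA₁₃ θ hP K₀ g₀ os) (weightB₁₃ θ hP K₀ g₀ os) (badClass₁₃ θ K₀ g₀ jcut) W) :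
    RelWeightBound (crOfRecord₁₃VAt K₀ jcut sh F θ hP g₀ os).l₀ (crOfRecord₁₃VAt K₀ jcut sh F θ hP g₀ os).T (crOfRecord₁₃VAt K₀ jcut sh F θ hP g₀ os).A
      (crOfRecord₁₃VAt K₀ jcut sh F θ hP g₀ os).B (crOfRecord₁₃VAt K₀ jcut sh F θ hP g₀ os).Bad (crOfRecord₁₃VAt K₀ jcut sh F θ hP g₀ os).W :=
  relWeightBound_wInf h

/-- ★ **N21 AT THE READING FROM ANY WITNESS**. [bookkeeping] -/
theorem shellWeightBound_crOfRecord₁₃VAt {Wsh : ℕ → ℝ}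
    (h : ShellWeightBound 1 (classSet₁₃ θ K₀ g₀) (weightA₁₃ θ hP K₀ g₀ os) (weightB₁₃ θ hP K₀ g₀ os) (sh F θ hP g₀ os).1 (sh F θ hP g₀ os).2 Wsh) :
    ShellWeightBound (crOfRecord₁₃VAt K₀ jcut sh F θ hP g₀ os).l₀ (crOfRecord₁₃VAt K₀ jcut sh F θ hP g₀ os).T (crOfRecord₁₃VAt K₀ jcut sh F θ hP g₀ os).A
      (crOfRecord₁₃VAt K₀ jcut sh F θ hP g₀ os).B (crOfRecord₁₃VAt K₀ jcut sh F θ hP g₀ os).shA (crOfRecord₁₃VAt K₀ jcut sh F θ hP g₀ os).shB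
      (crOfRecord₁₃VAt K₀ jcut sh F θ hP g₀ os).Wsh :=
  shellWeightBound_wshInf h

/-- ★ **N19′'s CORE AND U4′'s SUMMABILITY AT THE READING's OWN RATE FROM ANY WITNESS** (sandwich at volume `F.side ^ 4`; non-negative cores from any shell witness).
[bookkeeping] -/
theorem core_crOfRecord₁₃VAt {δ : ℕ → ℝ}
    (hP0 : letI : DecidableEq (Σ K, SiteSeqKey F (K₀ + K)) := Classical.decEq _
      ∀ (K : ℕ) (t : ℝ), |t| ≤ 1 → ∀ x ∈ classSet₁₃ θ K₀ g₀ K \ badClass₁₃ θ K₀ g₀ jcut K t, 0 ≤ weightA₁₃ θ hP K₀ g₀ os K t x - (sh F θ hP g₀ os).1 K t x)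
    (h : letI : DecidableEq (Σ K, SiteSeqKey F (K₀ + K)) := Classical.decEq _
      NE7.Core 1 (F.side ^ 4) (classSet₁₃ θ K₀ g₀) (badClass₁₃ θ K₀ g₀ jcut) (fun K t x => weightA₁₃ θ hP K₀ g₀ os K t x - (sh F θ hP g₀ os).1 K t x)
        (fun K t x => weightB₁₃ θ hP K₀ g₀ os K t x - (sh F θ hP g₀ os).2 K t x) δ)
    (hδ : Summable δ) :
    (letI := (crOfRecord₁₃VAt K₀ jcut sh F θ hP g₀ os).dec
     NE7.Core (crOfRecord₁₃VAt K₀ jcut sh F θ hP g₀ os).l₀ (crOfRecord₁₃VAt K₀ jcut sh F θ hP g₀ os).vol (crOfRecord₁₃VAt K₀ jcut sh F θ hP g₀ os).T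
      (crOfRecord₁₃VAt K₀ jcut sh F θ hP g₀ os).Bad
      (fun K t τ => (crOfRecord₁₃VAt K₀ jcut sh F θ hP g₀ os).A K t τ - (crOfRecord₁₃VAt K₀ jcut sh F θ hP g₀ os).shA K t τ)
      (fun K t τ => (crOfRecord₁₃VAt K₀ jcut sh F θ hP g₀ os).B K t τ - (crOfRecord₁₃VAt K₀ jcut sh F θ hP g₀ os).shB K t τ)
      (crOfRecord₁₃VAt K₀ jcut sh F θ hP g₀ os).δ) ∧ Summable (crOfRecord₁₃VAt K₀ jcut sh F θ hP g₀ os).δ := by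
  letI : DecidableEq (Σ K, SiteSeqKey F (K₀ + K)) := Classical.decEq _
  letI := (crOfRecord₁₃VAt K₀ jcut sh F θ hP g₀ os).dec
  exact ⟨core_deltaCan (pow_pos F.side_pos 4).le hP0 h, summable_deltaCan (pow_pos F.side_pos 4).le hP0 h hδ⟩

/-- **U4′'s `W + Wsh < 1` AT THE READING FROM ANY WITNESSES**. [bookkeeping] -/
theorem lt_one_crOfRecord₁₃VAt {W Wsh : ℕ → ℝ}
    (hW : RelWeightBound 1 (classSet₁₃ θ K₀ g₀) (weightA₁₃ θ hP K₀ g₀ os) (weightB₁₃ θ hP K₀ g₀ os) (badClass₁₃ θ K₀ g₀ jcut) W)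
    (hSh : ShellWeightBound 1 (classSet₁₃ θ K₀ g₀) (weightA₁₃ θ hP K₀ g₀ os) (weightB₁₃ θ hP K₀ g₀ os) (sh F θ hP g₀ os).1 (sh F θ hP g₀ os).2 Wsh)
    (hlt : ∀ K, W K + Wsh K < 1) (K : ℕ) :
    (crOfRecord₁₃VAt K₀ jcut sh F θ hP g₀ os).W K + (crOfRecord₁₃VAt K₀ jcut sh F θ hP g₀ os).Wsh K < 1 :=
  wInf_add_wshInf_lt_one hW hSh hlt K

end Transfer

end YMDAG.UVSplit

end
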